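import Summits.KontsevichZagierPeriods.KontsevichZagierPeriods.Theorems.SoloInformedAlgPiece
import HarnessLib
import HarnessLib.Audit

/-!
# SoloInformed — the period conjecture for algebraic-coefficient rational integrals of dimension 1 (bounded domains)

Solo programme `solo-KontsevichZagierPeriods-informed`, session s112, file 15.

**Theorem** (`soloInformed_segSpan_of_isAlgRationalOne_isBounded`,
`soloInformed_kzp_isAlgRationalOne_isBounded`, `soloInformed_sum_zsmul_of_mem_relations_alg`).
Let `r = [D, f]` be an integral representation of dimension `1` with BOUNDED `ℚ`-semialgebraic
domain `D ⊆ ℝ` whose integrand is `f = Re(P/Q)` on `D` for some `P, Q ∈ ℚ̄[X]`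
(`ℚ̄ = algebraicClosure ℚ ℂ`) with `Q` pole-free at the real points of the closure of `D` — in
particular every `∫_D N(x)/M(x) dx` with `N, M` real polynomials with real ALGEBRAIC coefficients and
`M ≠ 0` on `D̄`.  Then `of r` lies in the span of points and segments; consequently
(i) two such representations with the same value are KZ-equivalent, (ii) such a representation and
a rational representation of dimension `≤ 1` with the same value are KZ-equivalent, and
(iii) every vanishing `ℤ`-combination of values of such representations is a relation.
This is the one-variable content of Kontsevich–Zagier's remark (*Periods*, §1.1) that "rational"
may be replaced by "algebraic", proved inside the move calculus.

Proof: the cylindrical-decomposition skeleton of file 10 with the algebraic piece lemma of file 14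
on each open cell (the closed cell lies in `D̄`, where `Q` has no zero).  The unbounded case
(projective charts preserve the class) and poles on `∂D` are not treated here.

Honest placement: the `ℚ`-coefficient sector (`IsRational`, any domain) is in the tree
(`kzPeriodConjecture_dim_le_one` by other seats; files 10–11 here); the algebraic-coefficient class
is, to this seat's knowledge (name search only: membrane), new in the tree.

References: M. Kontsevich, D. Zagier, *Periods* (2001), §1.1–1.2; A. Baker, *Transcendental Number
Theory* (1975), Thm. 2.1.
-/

noncomputable section

open scoped BigOperators Polynomial

namespace Summit.KontsevichZagierPeriods.KontsevichZagierPeriods.Theorems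

open Set MeasureTheory
open Literature.ModelTheory.ExponentialFields
open Literature.NumberTheory.Transcendental Literature.NumberTheory.Transcendental.KZ

/-- **Bounded pieces with integrand `Re(P/Q)`, `Q` pole-free on the closure, lie in the span of
points and segments.** [Kontsevich–Zagier 2001, §1.1–1.2; this work] -/
theorem soloInformed_segSpan_of_algFun_isBounded_one (r : IntegralRep 1)
    (PL QL : (algebraicClosure ℚ ℂ)[X])
    (hQ : ∀ x ∈ closure r.domain,
      (QL.map (algebraMap (algebraicClosure ℚ ℂ) ℂ)).eval ((x 0 : ℝ) : ℂ) ≠ 0)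
    (hpq : EqOn r.integrand (soloInformedAlgFun PL QL) r.domain)
    (hb : Bornology.IsBounded r.domain) :
    of r ∈ soloInformedSegSpan := by
  classical
  -- an adapted cylindrical decomposition of the line
  obtain ⟨𝒮, hcd, hF⟩ := IsSemialgebraic.exists_cylindricalDecomposition_holds (k := ℚ)
    ({r.domain} : Finset (Set (Fin 1 → ℝ))) (by simpa using r.isSemialgebraic_domain)
  obtain ⟨𝒞, h𝒞𝒮, h𝒞K⟩ := hF r.domain (by simp)
  obtain ⟨-, hsemi, 𝒮₀, h0, hstack⟩ := isCylindricalDecomposition_succ.1 hcd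
  have h0' : 𝒮₀ = {univ} := isCylindricalDecomposition_zero.1 h0
  subst h0'
  obtain ⟨l, ξ, -, hsa, hmono, hcells⟩ := hstack
  -- the sections over the point and their values
  set pt : Fin 0 → ℝ := Fin.elim0 with hpt
  set L := l univ with hL
  set ζ : Fin L → (Fin 0 → ℝ) → ℝ := ξ univ with hζ
  set c : Fin L → ℝ := fun j => ζ j pt with hc
  have hcmono : StrictMono c := hmono univ (by simp) pt (mem_univ _)
  have hinit : ∀ w : Fin 1 → ℝ, Fin.init w = pt := fun w => Subsingleton.elim _ _
  -- the graph cells are the points `c j`, which are therefore algebraic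
  have hgraph : ∀ j : Fin L, graphOver univ (ζ j) = {fun _ => c j} := fun j => by
    ext w
    rw [mem_graphOver_iff, hinit w, mem_singleton_iff]
    simp only [mem_univ, true_and]
    constructor
    · intro h; rw [KZ.eq_const_apply_zero w]; exact congrArg (fun t => fun _ : Fin 1 => t) h
    · intro h; rw [h]
  have halg : ∀ j : Fin L, IsAlgebraic ℚ (c j) := fun j => by
    have hmem : graphOver univ (ζ j) ∈ 𝒮 := (hcells _).2 ⟨univ, by simp, Or.inl ⟨j, rfl⟩⟩
    have hs := hsemi _ hmem
    rw [hgraph j] at hs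
    exact isAlgebraic_of_mem_of_finite hs (finite_singleton _) (mem_singleton _)
  -- the index set: bands contained in the (bounded) domain; they are interior bands
  let ι := {j : Fin (L + 1) // bandOver univ ζ j ∈ 𝒞}
  have hsubD : ∀ i : ι, bandOver univ ζ i.1 ⊆ r.domain := fun i =>
    h𝒞K ▸ subset_sUnion_of_mem i.2
  have hne0 : ∀ i : ι, i.1 ≠ 0 := fun i h =>
    soloInformed_band_zero_not_isBounded ζ (hb.subset (h ▸ hsubD i))
  have hnel : ∀ i : ι, i.1 ≠ Fin.last L := fun i h =>
    soloInformed_band_last_not_isBounded ζ (hb.subset (h ▸ hsubD i))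
  set lo : ι → ℝ := fun i => c (i.1.pred (hne0 i)) with hlo
  set hi : ι → ℝ := fun i => c (i.1.castPred (hnel i)) with hhi
  have hlohi : ∀ i, lo i < hi i := fun i => hcmono (by
    rw [Fin.lt_def, Fin.val_pred, Fin.coe_castPred]
    have h1 : (i.1 : ℕ) ≠ 0 := fun h => hne0 i (Fin.ext h)
    omega)
  have hband : ∀ i : ι, bandOver univ ζ i.1 = {w | ∀ k, lo i < w k ∧ w k < hi i} := fun i => by
    ext w
    rw [mem_bandOver_iff, bandLower_of_ne_zero ζ i.1 (hne0 i), bandUpper_of_ne_last ζ i.1 (hnel i),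
      hinit w, EReal.coe_lt_coe_iff, EReal.coe_lt_coe_iff]
    simp only [mem_univ, true_and, mem_setOf_eq]
    constructor
    · rintro h ⟨k, hk⟩
      have hk0 : k = 0 := by omega
      subst hk0
      exact h
    · intro h
      exact h (Fin.last 0)
  have hbandS : ∀ i : ι, IsSemialgebraic ℚ {w : Fin 1 → ℝ | ∀ k, lo i < w k ∧ w k < hi i} :=
    fun i => hband i ▸ hsemi _ (h𝒞𝒮 i.2)
  have hbandD : ∀ i : ι, {w : Fin 1 → ℝ | ∀ k, lo i < w k ∧ w k < hi i} ⊆ r.domain :=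
    fun i => hband i ▸ hsubD i
  -- the pieces
  set R : ι → IntegralRep 1 := fun i => r.restrict _ (hbandS i) (hbandD i) with hR
  -- the closed cells lie in the closure of the domain, so `Q` is pole-free on them
  have hclos : ∀ i : ι, ∀ t ∈ Icc (lo i) (hi i), (fun _ : Fin 1 => t) ∈ closure r.domain := by
    intro i t ht
    refine closure_mono (hbandD i) ?_
    have hpi : {w : Fin 1 → ℝ | ∀ k, lo i < w k ∧ w k < hi i} =
        Set.pi univ (fun _ : Fin 1 => Ioo (lo i) (hi i)) := by
      ext w
      simp only [mem_setOf_eq, mem_univ_pi, mem_Ioo]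
    rw [hpi, closure_pi_set, mem_univ_pi]
    intro k
    rw [closure_Ioo (hlohi i).ne]
    exact ht
  have hQI : ∀ i : ι, ∀ t ∈ Icc (lo i) (hi i),
      (QL.map (algebraMap (algebraicClosure ℚ ℂ) ℂ)).eval (t : ℂ) ≠ 0 := fun i t ht =>
    hQ (fun _ => t) (hclos i t ht)
  have hpieces : ∀ i, of (R i) ∈ soloInformedSegSpan := fun i =>
    soloInformed_restrict_interval_mem_segSpan_alg r PL QL (hlohi i) (halg _) (halg _) (hQI i)
      (hbandS i) (hbandD i) (hpq.mono (hbandD i))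
  -- rule (1) over the almost-partition of the domain by the bands
  have hpart : of r - ∑ i, of (R i) ∈ relations := by
    refine KZ.of_sub_sum_of_mem_relations Finset.univ r R (fun i _ => ?_) (fun i _ _ _ => rfl)
      ?_ ?_
    · rw [show (R i).domain \ r.domain = ∅ from
        Set.eq_empty_of_subset_empty fun w hw => hw.2 (hbandD i hw.1), measure_empty]
    · -- the uncovered part of the domain consists of graph cells: finitely many points
      refine measure_mono_null (fun w hw => ?_)
        ((Set.finite_range fun j : Fin L => (fun _ => c j : Fin 1 → ℝ)).measure_zero volume)
      obtain ⟨hwD, hwU⟩ := hw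
      have hwD' : w ∈ ⋃₀ (𝒞 : Set (Set (Fin 1 → ℝ))) := by rw [h𝒞K]; exact hwD
      obtain ⟨T, hT𝒞, hwT⟩ := mem_sUnion.1 hwD'
      obtain ⟨S, hS, hT⟩ := (hcells T).1 (h𝒞𝒮 hT𝒞)
      rw [Finset.mem_singleton] at hS
      subst hS
      rcases hT with ⟨j, rfl⟩ | ⟨j, rfl⟩
      · rw [hgraph j, mem_singleton_iff] at hwT
        exact ⟨j, hwT.symm⟩
      · refine (hwU ?_).elim
        refine mem_iUnion₂.2 ⟨⟨j, hT𝒞⟩, Finset.mem_univ _, ?_⟩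
        show w ∈ {w : Fin 1 → ℝ | ∀ k, lo ⟨j, hT𝒞⟩ < w k ∧ w k < hi ⟨j, hT𝒞⟩}
        rw [← hband ⟨j, hT𝒞⟩]
        exact hwT
    · -- distinct interior bands are disjoint
      intro i _ j _ hij
      suffices h : {w : Fin 1 → ℝ | ∀ k, lo i < w k ∧ w k < hi i} ∩
          {w | ∀ k, lo j < w k ∧ w k < hi j} = ∅ by
        show volume ({w : Fin 1 → ℝ | ∀ k, lo i < w k ∧ w k < hi i} ∩
          {w | ∀ k, lo j < w k ∧ w k < hi j}) = 0
        rw [h]; exact measure_empty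
      ext w
      simp only [mem_inter_iff, mem_setOf_eq, mem_empty_iff_false, iff_false, not_and]
      intro hwi hwj
      have hij' : i.1 ≠ j.1 := fun h => hij (Subtype.ext h)
      rcases lt_or_gt_of_ne hij' with hlt | hgt
      · have hle : hi i ≤ lo j := hcmono.monotone (by
          rw [Fin.le_def, Fin.val_pred, Fin.coe_castPred]; rw [Fin.lt_def] at hlt; omega)
        linarith [(hwi 0).2, (hwj 0).1]
      · have hle : hi j ≤ lo i := hcmono.monotone (by
          rw [Fin.le_def, Fin.val_pred, Fin.coe_castPred]; rw [Fin.lt_def] at hgt; omega)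
        linarith [(hwj 0).2, (hwi 0).1]
  exact soloInformed_mem_segSpan_of_sub_mem hpart
    (soloInformed_sum_mem_segSpan _ fun i _ => hpieces i)

/-- The ALGEBRAIC-COEFFICIENT RATIONAL CLASS in dimension `1`: the integrand is `Re(P/Q)` on the
domain for some `P, Q ∈ ℚ̄[X]` with `Q` pole-free at the real points of the closure of the domain.
(Every real rational function with real algebraic coefficients and no pole on `D̄` is of this form.)
-/
def SoloInformedIsAlgRationalOne (r : IntegralRep 1) : Prop :=
  ∃ PL QL : (algebraicClosure ℚ ℂ)[X],
    (∀ x ∈ closure r.domain,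
      (QL.map (algebraMap (algebraicClosure ℚ ℂ) ℂ)).eval ((x 0 : ℝ) : ℂ) ≠ 0) ∧
    EqOn r.integrand (soloInformedAlgFun PL QL) r.domain

/-- Rational representations need not be in the class (poles on `∂D` are allowed there), but every
`ℚ`-coefficient pair `P, Q` read in `ℚ̄[X]` gives the same real function: the class contains the
pole-free-on-the-closure rational representations. -/
theorem soloInformed_algFun_of_rat (P Q : ℚ[X]) (y : Fin 1 → ℝ) :
    soloInformedAlgFun (P.map (algebraMap ℚ (algebraicClosure ℚ ℂ)))
        (Q.map (algebraMap ℚ (algebraicClosure ℚ ℂ))) y =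
      (Polynomial.aeval (y 0) P : ℝ) / Polynomial.aeval (y 0) Q := by
  have hev : ∀ R : ℚ[X], ((R.map (algebraMap ℚ (algebraicClosure ℚ ℂ))).map
      (algebraMap (algebraicClosure ℚ ℂ) ℂ)).eval ((y 0 : ℝ) : ℂ) =
        ((Polynomial.aeval (y 0) R : ℝ) : ℂ) := fun R => by
    rw [Polynomial.map_map, ← IsScalarTower.algebraMap_eq, Polynomial.eval_map,
      ← Polynomial.aeval_def, ← Complex.coe_algebraMap, Polynomial.aeval_algebraMap_apply]
  unfold soloInformedAlgFun
  rw [hev, hev, ← Complex.ofReal_div, Complex.ofReal_re]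

/-- **Members of the algebraic class with bounded domain lie in the span of points and segments.**
[this work] -/
theorem soloInformed_segSpan_of_isAlgRationalOne_isBounded (r : IntegralRep 1)
    (hr : SoloInformedIsAlgRationalOne r) (hb : Bornology.IsBounded r.domain) :
    of r ∈ soloInformedSegSpan := by
  obtain ⟨PL, QL, hQ, hpq⟩ := hr
  exact soloInformed_segSpan_of_algFun_isBounded_one r PL QL hQ hpq hb

/-- **The Kontsevich–Zagier period conjecture for the algebraic-coefficient rational class of
dimension `1` on bounded domains** (unconditional): equal values ⇒ KZ-equivalent; and against every
rational representation of dimension `≤ 1`. [Kontsevich–Zagier 2001, §1.2 Question 1; this work] -/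
theorem soloInformed_kzp_isAlgRationalOne_isBounded (r r' : IntegralRep 1)
    (hr : SoloInformedIsAlgRationalOne r) (hr' : SoloInformedIsAlgRationalOne r')
    (hb : Bornology.IsBounded r.domain) (hb' : Bornology.IsBounded r'.domain) :
    (r.value = r'.value → Equivalent r r') ∧
      ∀ {n : ℕ} (hn : n ≤ 1) (r₀ : IntegralRep n), r₀.IsRational → r.value = r₀.value →
        Equivalent r r₀ :=
  ⟨fun hv => soloInformed_equivalent_of_mem_segSpan
      (soloInformed_segSpan_of_isAlgRationalOne_isBounded r hr hb)
      (soloInformed_segSpan_of_isAlgRationalOne_isBounded r' hr' hb') hv,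
    fun hn r₀ hr₀ hv => soloInformed_equivalent_of_mem_segSpan
      (soloInformed_segSpan_of_isAlgRationalOne_isBounded r hr hb)
      (soloInformed_of_mem_segSpan_of_isRational hn r₀ hr₀) hv⟩

/-- **Kernel form for the algebraic class**: a `ℤ`-combination of bounded members of the class with
vanishing total value is a Kontsevich–Zagier relation. [this work] -/
theorem soloInformed_sum_zsmul_of_mem_relations_alg {ι : Type*} (s : Finset ι)
    (r : ι → IntegralRep 1) (c : ι → ℤ) (hr : ∀ i ∈ s, SoloInformedIsAlgRationalOne (r i))
    (hb : ∀ i ∈ s, Bornology.IsBounded (r i).domain)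
    (h0 : ∑ i ∈ s, (c i : ℝ) * (r i).value = 0) :
    ∑ i ∈ s, c i • of (r i) ∈ relations := by
  refine soloInformed_mem_relations_of_mem_segSpan
    (AddSubgroup.sum_mem _ fun i hi => AddSubgroup.zsmul_mem _
      (soloInformed_segSpan_of_isAlgRationalOne_isBounded (r i) (hr i hi) (hb i hi)) _) ?_
  rw [map_sum]
  simpa only [map_zsmul, eval_of, zsmul_eq_mul] using h0

end Summit.KontsevichZagierPeriods.KontsevichZagierPeriods.Theorems
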